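import Literature.AlgebraicGeometry.HodgeTheory.VHSDataLocallyFlatCharted
import Literature.AlgebraicGeometry.HodgeTheory.VHSDataDualChart
import HarnessLib

/-!
# Period charts are transported along isometric isomorphisms of VHS data; charts of `f^*(T^{a,b}D)`, `f^*(D^∨)`, `f^*Hom(D₁, D₂)` from charts of
# `f^*D`, `f^*D₁`, `f^*D₂`

Topic `Literature/AlgebraicGeometry/HodgeTheory` (namespace `Literature.AlgebraicGeometry.Motives.VHSData[.Iso ∕ .InteriorChart ∕ .PunctureChart ∕ …]`),
lane `lit-hodgefound` (seat `p08`, row g60-#7).  DEFINITIONS WITH BODIES (`VHSData.Iso.appRatEquiv` — the rational fibre isomorphism of an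
isomorphism of VHS data —, **`InteriorChart.ofIso`**, **`PunctureChart.ofIso`** — the period charts of `D₁` induced by an isometric isomorphism
`D₁ ≅ D₂` and charts of `D₂`) and THEOREMS; no named fact, no instance, no notation (D-0026 net debt `0`).  Sequel of `Motives/FamiliesVHSIso`
(`VHSData.Iso`, `Hom.IsIsometry`, invariance of the Hodge LOCI) on the side of the CHARTS of `HodgeTheory/VHSDataInteriorChart`, `…PunctureChart`,
`…FlatCharts`, `…LocallyChartedLift`, `…LocallyFlatCharted`.

PRINTED SOURCES, VERBATIM.  W. Schmid, *Variation of Hodge structure: the singularities of the period mapping*, Invent. Math. 22 (1973), §2: a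
variation of Hodge structure is the flat bundle with its flat polarization and Hodge filtration, considered up to isomorphism; the period map of
§3–§4 and the nilpotent orbit (4.9)–(4.12) are read in ANY flat trivialization.  C. Voisin, *Hodge Theory and Complex Algebraic Geometry I*, §7.3.1
(morphisms of variations: flat maps, morphisms of Hodge structures fibrewise).  J. Carlson, S. Müller-Stach, C. Peters, *Period Mappings and Period
Domains* (2nd ed. 2017), §2.3 eq. (2.6), Thm. 2.3.3 (the Hodge metric `h(u,v) = Q(Cu, v̄)` is determined by `Q` and the Hodge structure, hence
preserved by isometric isomorphisms).  E. Cattani, P. Deligne, A. Kaplan, *On the locus of Hodge classes*, J. AMS 8 (1995), §1 (p. 484) and «Proof of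
1.5 ⟹ 1.1» (p. 485): the tensor constructions `T^{a,b}𝒱` of `f^*𝒱` on the finite étale cover are `f^*` of those of `𝒱`.  P. Deligne, *Équations
différentielles à points singuliers réguliers*, LNM 163 (1970), I.1 (`f^*` is a `⊗`-functor on local systems).

CONTENT.
* §1 `Iso.appRatEquiv e s : V₁,s ≃ V₂,s` (the rationalization of the lattice isomorphism), **`Hom.appRat_transport`** (rational flatness of a morphism:
  `φ_t ∘ γ_* = γ_* ∘ φ_s` on `V`, from the integral flatness `Hom.app_transport` by `ℚ`-linear extension), **`Iso.map_hodge_F_baseChange_appRat`**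
  (`φ_ℂ F₁^q = F₂^q` for an isomorphism), **`Iso.hodgeNorm_baseChange_appRat`** (`‖φ_ℂ x‖₂ = ‖x‖₁` for an ISOMETRIC isomorphism: the tree's
  `Polarization.hodgeNorm_comap`).
* §2 **`InteriorChart.ofIso e he C`**: an isometric isomorphism `e : D₁ ≅ D₂` and an interior chart `C` of `D₂` on a disc `ψ` give the interior chart of
  `D₁` on `ψ` with trivialization `C.e c ∘ φ_{ψ⁻¹ c}`, the SAME reference structure, frame `h`, lattice `Λ` and constant `κ`; `IsFlat.ofIso`.
* §3 **`PunctureChart.ofIso e he C`**: the same for puncture charts (same limit mixed Hodge structure, gauge `Γ`, lattice, height); `IsFlat.ofIso`.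
* §4 the bundles: `IsCharted.ofIso`, `IsFlatCharted.ofIso`, `IsLocallyCharted.ofIso`, `IsLocallyFlatCharted.ofIso` (charts of `D₂` ⟹ charts of `D₁`
  for `D₁ ≅ D₂` isometric), and the symmetric forms `…_iff`.
* §5 APPLICATIONS through the tree's isometric isomorphisms `Iso.tensorSpaceComap`, `Iso.dualComap`, `Iso.homComap` (`Motives/FamiliesVHSComapTensor`):
  **`IsLocallyFlatCharted.comap_tensorSpace`** (flat charts of `f^*(T^{a,b}D)` from flat charts of `f^*D`), `…comap_dual`, `…comap_hom`, and the
  `IsLocallyCharted` forms — so that every statement of the chart layer about `T^{a,b}(f^*D)` is available for `f^*(T^{a,b}D)` verbatim.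

HONEST SCOPE.  Charts remain HYPOTHESIS structures (holomorphy of the period map, nilpotent orbit theorem); this file only shows they are insensitive to
isometric isomorphism of the data.  `Iso` alone (no isometry) does not transport interior charts: the metric comparison constant needs `Q`.

## References

* [Schmid1973] W. Schmid, *Variation of Hodge structure: the singularities of the period mapping*, Invent. Math. 22 (1973), §2, (4.9)–(4.12).
* [VoisinHodgeI2002] C. Voisin, *Hodge Theory and Complex Algebraic Geometry I*, CUP 2002, §7.3.1.
* [CarlsonMullerStachPeters2017] J. Carlson, S. Müller-Stach, C. Peters, *Period Mappings and Period Domains*, 2nd ed., CUP 2017, §2.3 eq. (2.6), Thm. 2.3.3.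
* [CattaniDeligneKaplan1995] E. Cattani, P. Deligne, A. Kaplan, *On the locus of Hodge classes*, J. Amer. Math. Soc. 8 (1995) 483–506, §1 (p. 484),
  «Proof of 1.5 ⟹ 1.1» (p. 485).
* [Deligne1970] P. Deligne, *Équations différentielles à points singuliers réguliers*, LNM 163 (1970), I.1.
-/

noncomputable section

open scoped TensorProduct ComplexOrder
open _root_.Topology _root_.Filter Set

universe u

namespace Literature.AlgebraicGeometry

open Motives Motives.HodgeStructure HodgeTheory Topology
open Motives.HodgeStructure (conj ofRat ofRat_apply conj_ofRat)

namespace Motives.VHSData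

variable {S : Type} [TopologicalSpace S] {k : ℤ} {D₁ D₂ : VHSData S k}

/-! ## §1 The rational fibre isomorphism of an isomorphism of VHS data; flatness, filtrations, Hodge norms -/

/-- **Rational flatness of a morphism of VHS data**: `φ_t (γ · x) = γ · (φ_s x)` on the rational local systems (both sides are `ℚ`-linear in `x` and
agree on `V_ℤ,s`, where it is the integral flatness `Hom.app_transport`). [cite: VoisinHodgeI2002, §7.3.1] [cite: Deligne1970, I.1] -/
theorem Hom.appRat_transport (φ : Hom D₁ D₂) {s t : S} (γ : Path.Homotopic.Quotient s t) (x : D₁.V.fiber s) :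
    φ.appRat t (D₁.V.transport γ x) = D₂.V.transport γ (φ.appRat s x) := by
  have h : φ.appRat t ∘ₗ D₁.V.transport γ = D₂.V.transport γ ∘ₗ φ.appRat s := by
    refine (D₁.isBaseChange_toRatLinear ⟨s⟩).algHom_ext _ _ fun m => ?_
    change φ.appRat t (D₁.V.transport γ (D₁.toRat s m)) = D₂.V.transport γ (φ.appRat s (D₁.toRat s m))
    rw [D₁.transport_toRat, Hom.appRat_toRat, Hom.appRat_toRat, D₂.transport_toRat, Hom.app_transport]
  exact LinearMap.congr_fun h x

/-- Rational flatness as an identity of linear maps. [cite: VoisinHodgeI2002, §7.3.1] [cite: Deligne1970, I.1] -/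
theorem Hom.appRat_comp_transport (φ : Hom D₁ D₂) {s t : S} (γ : Path.Homotopic.Quotient s t) :
    φ.appRat t ∘ₗ D₁.V.transport γ = D₂.V.transport γ ∘ₗ φ.appRat s :=
  LinearMap.ext (φ.appRat_transport γ)

namespace Iso

/-- **The rational fibre isomorphism `V₁,s ≃ V₂,s` of an isomorphism of VHS data** (rationalizations of `hom_s`, `inv_s`).
[cite: VoisinHodgeI2002, §7.3.1] [cite: Schmid1973, §2] -/
def appRatEquiv (e : Iso D₁ D₂) (s : S) : D₁.V.fiber s ≃ₗ[ℚ] D₂.V.fiber s :=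
  LinearEquiv.ofLinear (e.hom.appRat s) (e.inv.appRat s) (e.hom_appRat_comp_inv_appRat s) (e.inv_appRat_comp_hom_appRat s)

/-- `appRatEquiv e s x = hom_ℚ x`. [cite: VoisinHodgeI2002, §7.3.1] -/
@[simp] theorem appRatEquiv_apply (e : Iso D₁ D₂) (s : S) (x : D₁.V.fiber s) : e.appRatEquiv s x = e.hom.appRat s x := rfl

/-- `(appRatEquiv e s)⁻¹ y = inv_ℚ y`. [cite: VoisinHodgeI2002, §7.3.1] -/
@[simp] theorem appRatEquiv_symm_apply (e : Iso D₁ D₂) (s : S) (y : D₂.V.fiber s) : (e.appRatEquiv s).symm y = e.inv.appRat s y := rfl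

/-- The underlying linear map of `appRatEquiv e s` is `hom_ℚ`. [cite: VoisinHodgeI2002, §7.3.1] -/
@[simp] theorem coe_appRatEquiv (e : Iso D₁ D₂) (s : S) : (e.appRatEquiv s : D₁.V.fiber s →ₗ[ℚ] D₂.V.fiber s) = e.hom.appRat s := rfl

/-- `hom_ℂ (inv_ℂ y) = y`. [cite: VoisinHodgeI2002, §7.3.1] -/
theorem baseChange_appRat_hom_inv (e : Iso D₁ D₂) (s : S) (y : ℂ ⊗[ℚ] D₂.V.fiber s) :
    (e.hom.appRat s).baseChange ℂ ((e.inv.appRat s).baseChange ℂ y) = y := by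
  rw [← LinearMap.comp_apply, ← LinearMap.baseChange_comp, e.hom_appRat_comp_inv_appRat, LinearMap.baseChange_id, LinearMap.id_apply]

/-- `inv_ℂ (hom_ℂ x) = x`. [cite: VoisinHodgeI2002, §7.3.1] -/
theorem baseChange_appRat_inv_hom (e : Iso D₁ D₂) (s : S) (x : ℂ ⊗[ℚ] D₁.V.fiber s) :
    (e.inv.appRat s).baseChange ℂ ((e.hom.appRat s).baseChange ℂ x) = x := by
  rw [← LinearMap.comp_apply, ← LinearMap.baseChange_comp, e.inv_appRat_comp_hom_appRat, LinearMap.baseChange_id, LinearMap.id_apply]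

/-- **An isomorphism of VHS data identifies the Hodge filtrations: `hom_ℂ F₁^q = F₂^q`** (`hom` and `inv` both respect the filtrations).
[cite: VoisinHodgeI2002, §7.3.1 and Lemma 7.25] -/
theorem map_hodge_F_baseChange_appRat (e : Iso D₁ D₂) (s : S) (q : ℤ) :
    ((D₁.hodge s).F q).map ((e.hom.appRat s).baseChange ℂ) = (D₂.hodge s).F q := by
  refine le_antisymm ((e.hom.hodgeHom s).map_F_le q) fun y hy => ?_
  exact ⟨(e.inv.appRat s).baseChange ℂ y, (e.inv.hodgeHom s).map_F_le q ⟨y, hy, rfl⟩, e.baseChange_appRat_hom_inv s y⟩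

/-- The same for the rational fibre isomorphism. [cite: VoisinHodgeI2002, §7.3.1] -/
theorem map_hodge_F_baseChange_appRatEquiv (e : Iso D₁ D₂) (s : S) (q : ℤ) :
    ((D₁.hodge s).F q).map ((e.appRatEquiv s).toLinearMap.baseChange ℂ) = (D₂.hodge s).F q :=
  e.map_hodge_F_baseChange_appRat s q

/-- `hom_ℚ` is injective. [cite: VoisinHodgeI2002, §7.3.1] -/
theorem hom_appRat_injective (e : Iso D₁ D₂) (s : S) : Function.Injective (e.hom.appRat s) :=
  (e.appRatEquiv s).injective

/-- **An ISOMETRIC isomorphism preserves the Hodge norms: `‖hom_ℂ x‖₂ = ‖x‖₁`** (the Hodge metric is `Q(C·, ·̄)` and `hom` commutes with the Weil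
operators, with conjugation and with `Q`). [cite: CarlsonMullerStachPeters2017, §2.3 eq. (2.6) and Thm. 2.3.3] [cite: Schmid1973, §2] -/
theorem hodgeNorm_baseChange_appRat (e : Iso D₁ D₂) (he : e.hom.IsIsometry) (s : S) (x : ℂ ⊗[ℚ] D₁.V.fiber s) :
    (D₂.form s).hodgeNorm ((e.hom.appRat s).baseChange ℂ x) = (D₁.form s).hodgeNorm x := by
  have hinj : Function.Injective (e.hom.hodgeHom s).toLinearMap := e.hom_appRat_injective s
  have h := Polarization.hodgeNorm_comap (D₂.form s) (e.hom.hodgeHom s) hinj x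
  rw [Hom.hodgeHom_toLinearMap] at h
  rw [← h]
  have hform : ((D₂.form s).comap (e.hom.hodgeHom s) hinj).form = (D₁.form s).form :=
    LinearMap.ext fun x => LinearMap.ext fun y => he s x y
  unfold Polarization.hodgeNorm
  rw [hform]

/-- On rational vectors: `‖1 ⊗ hom_ℚ x‖₂ = ‖1 ⊗ x‖₁`. [cite: CarlsonMullerStachPeters2017, §2.3 Thm. 2.3.3] -/
theorem hodgeNorm_ofRat_appRat (e : Iso D₁ D₂) (he : e.hom.IsIsometry) (s : S) (x : D₁.V.fiber s) :
    (D₂.form s).hodgeNorm (ofRat (e.hom.appRat s x)) = (D₁.form s).hodgeNorm (ofRat x) := by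
  rw [← e.hodgeNorm_baseChange_appRat he s (ofRat x), ofRat_apply, ofRat_apply, LinearMap.baseChange_tmul]

end Iso

/-! ## §2 Interior charts along an isometric isomorphism -/

namespace InteriorChart

variable {V : Type u} [AddCommGroup V] [Module ℚ V] {H₀ : HodgeStructure V k} {P₀ : H₀.Polarization} {ψ : OpenPartialHomeomorph S ℂ}

/-- **THE INTERIOR CHART OF `D₁` INDUCED BY AN ISOMETRIC ISOMORPHISM `e : D₁ ≅ D₂` AND AN INTERIOR CHART `C` OF `D₂`** on the disc `ψ`: the flat
trivialization is `C.e c ∘ hom_{ψ⁻¹ c} : V₁,ψ⁻¹(c) ≃ V`, with the SAME polarized reference Hodge structure `(H₀, P₀)`, inverse frame `h`, lattice `Λ`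
and metric constant `κ` — `hom` identifies the Hodge filtrations (`Iso.map_hodge_F_baseChange_appRat`), the forms (isometry), the lattices
(`hom V₁,ℤ = V₂,ℤ`) and the Hodge norms (`Iso.hodgeNorm_baseChange_appRat`). [cite: Schmid1973, §2] [cite: VoisinHodgeI2002, §7.3.1]
[cite: CarlsonMullerStachPeters2017, §2.3 Thm. 2.3.3] -/
def ofIso (e : Iso D₁ D₂) (he : e.hom.IsIsometry) (C : D₂.InteriorChart ψ P₀) : D₁.InteriorChart ψ P₀ where
  isPreconnected_target := C.isPreconnected_target
  e c := (e.appRatEquiv (ψ.symm c)).trans (C.e c)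
  h := C.h
  analyticOnNhd_h := C.analyticOnNhd_h
  isUnit_h := C.isUnit_h
  map_F_eq c hc q := by
    rw [LinearEquiv.coe_trans, LinearMap.baseChange_comp, Submodule.map_comp, Iso.map_hodge_F_baseChange_appRatEquiv]
    exact C.map_F_eq c hc q
  form_eq c hc x y := by
    rw [LinearEquiv.trans_apply, LinearEquiv.trans_apply, Iso.appRatEquiv_apply, Iso.appRatEquiv_apply, ← C.form_eq c hc]
    exact (he _ x y).symm
  Λ := C.Λ
  fg_Λ := C.fg_Λ
  e_toRat_mem c hc u := by
    rw [LinearEquiv.trans_apply, Iso.appRatEquiv_apply, Hom.appRat_toRat]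
    exact C.e_toRat_mem c hc _
  exists_e_toRat_eq c hc v hv := by
    obtain ⟨u, hu⟩ := C.exists_e_toRat_eq c hc v hv
    refine ⟨e.inv.app _ u, ?_⟩
    rw [LinearEquiv.trans_apply, Iso.appRatEquiv_apply, Hom.appRat_toRat, Iso.hom_app_inv_app]
    exact hu
  κ := C.κ
  κ_pos := C.κ_pos
  mul_hodgeNorm_le c hc x := by
    have h := C.mul_hodgeNorm_le c hc ((e.hom.appRat _).baseChange ℂ x)
    rw [e.hodgeNorm_baseChange_appRat he] at h
    rw [LinearEquiv.coe_trans, LinearMap.baseChange_comp, LinearMap.comp_apply]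
    exact h

/-- The trivialization of the induced chart is `C.e c ∘ hom`. [cite: Schmid1973, §2] -/
theorem ofIso_e_apply (e : Iso D₁ D₂) (he : e.hom.IsIsometry) (C : D₂.InteriorChart ψ P₀) (c : ℂ) (x : D₁.V.fiber (ψ.symm c)) :
    (C.ofIso e he).e c x = C.e c (e.hom.appRat (ψ.symm c) x) := rfl

/-- The induced chart has the same inverse frame. [cite: Schmid1973, §2] -/
@[simp] theorem ofIso_h (e : Iso D₁ D₂) (he : e.hom.IsIsometry) (C : D₂.InteriorChart ψ P₀) : (C.ofIso e he).h = C.h := rfl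

/-- The induced chart has the same lattice. [cite: Schmid1973, §2] -/
@[simp] theorem ofIso_Λ (e : Iso D₁ D₂) (he : e.hom.IsIsometry) (C : D₂.InteriorChart ψ P₀) : (C.ofIso e he).Λ = C.Λ := rfl

/-- The induced chart has the same metric constant. [cite: CarlsonMullerStachPeters2017, §2.3 Thm. 2.3.3] -/
@[simp] theorem ofIso_κ (e : Iso D₁ D₂) (he : e.hom.IsIsometry) (C : D₂.InteriorChart ψ P₀) : (C.ofIso e he).κ = C.κ := rfl

/-- **Flatness is transported**: if `C` is flat (identity transport along every in-disc path) then so is `C.ofIso e he` (`hom` is flat).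
[cite: Schmid1973, §2] [cite: Deligne1970, I.1] -/
theorem IsFlat.ofIso {e : Iso D₁ D₂} {he : e.hom.IsIsometry} {C : D₂.InteriorChart ψ P₀} (hC : C.IsFlat) : (C.ofIso e he).IsFlat :=
    fun c c' hc hc' γ hγ y => by
  rw [ofIso_e_apply, ofIso_e_apply, Hom.appRat_transport]
  exact hC hc hc' γ hγ _

end InteriorChart

/-! ## §3 Puncture charts along an isometric isomorphism -/

namespace PunctureChart

variable {V : Type u} [AddCommGroup V] [Module ℚ V] [FiniteDimensional ℚ V] {L : PolarizedLimitMixedHodgeStructure V k} {σ : ℂ → S}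

/-- **THE PUNCTURE CHART OF `D₁` INDUCED BY AN ISOMETRIC ISOMORPHISM `e : D₁ ≅ D₂` AND A PUNCTURE CHART `C` OF `D₂`** along the end `σ`: trivialization
`C.e z ∘ hom_{σ z}`, the SAME polarized limit mixed Hodge structure `L`, gauge `Γ`, lattice `Λ` and height `A₀` (the nilpotent orbit
`exp(zN) exp(Γ(s)) F` is read in any flat trivialization). [cite: Schmid1973, §2 and (4.9)–(4.12)] [cite: VoisinHodgeI2002, §7.3.1] -/
def ofIso (e : Iso D₁ D₂) (he : e.hom.IsIsometry) (C : D₂.PunctureChart σ L) : D₁.PunctureChart σ L where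
  Γ := C.Γ
  Γ_zero := C.Γ_zero
  analyticAt_Γ := C.analyticAt_Γ
  Γ_mem := C.Γ_mem
  Λ := C.Λ
  fg_Λ := C.fg_Λ
  monodromy_mem := C.monodromy_mem
  e z := (e.appRatEquiv (σ z)).trans (C.e z)
  A₀ := C.A₀
  map_F_eq z hz q := by
    rw [LinearEquiv.coe_trans, LinearMap.baseChange_comp, Submodule.map_comp, Iso.map_hodge_F_baseChange_appRatEquiv]
    exact C.map_F_eq z hz q
  form_eq z hz x y := by
    rw [LinearEquiv.trans_apply, LinearEquiv.trans_apply, Iso.appRatEquiv_apply, Iso.appRatEquiv_apply, ← C.form_eq z hz]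
    exact (he _ x y).symm
  e_toRat_mem z hz u := by
    rw [LinearEquiv.trans_apply, Iso.appRatEquiv_apply, Hom.appRat_toRat]
    exact C.e_toRat_mem z hz _
  exists_e_toRat_eq z hz v hv := by
    obtain ⟨u, hu⟩ := C.exists_e_toRat_eq z hz v hv
    refine ⟨e.inv.app _ u, ?_⟩
    rw [LinearEquiv.trans_apply, Iso.appRatEquiv_apply, Hom.appRat_toRat, Iso.hom_app_inv_app]
    exact hu

/-- The trivialization of the induced puncture chart is `C.e z ∘ hom`. [cite: Schmid1973, §2] -/
theorem ofIso_e_apply (e : Iso D₁ D₂) (he : e.hom.IsIsometry) (C : D₂.PunctureChart σ L) (z : ℂ) (x : D₁.V.fiber (σ z)) :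
    (C.ofIso e he).e z x = C.e z (e.hom.appRat (σ z) x) := rfl

/-- Same gauge. [cite: Schmid1973, (4.9)–(4.12)] -/
@[simp] theorem ofIso_Γ (e : Iso D₁ D₂) (he : e.hom.IsIsometry) (C : D₂.PunctureChart σ L) : (C.ofIso e he).Γ = C.Γ := rfl

/-- Same lattice. [cite: Schmid1973, §2] -/
@[simp] theorem ofIso_Λ (e : Iso D₁ D₂) (he : e.hom.IsIsometry) (C : D₂.PunctureChart σ L) : (C.ofIso e he).Λ = C.Λ := rfl

/-- Same height. [cite: Schmid1973, (4.9)–(4.12)] -/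
@[simp] theorem ofIso_A₀ (e : Iso D₁ D₂) (he : e.hom.IsIsometry) (C : D₂.PunctureChart σ L) : (C.ofIso e he).A₀ = C.A₀ := rfl

/-- **Flatness is transported** along an isometric isomorphism. [cite: Schmid1973, §2] [cite: Deligne1970, I.1] -/
theorem IsFlat.ofIso {e : Iso D₁ D₂} {he : e.hom.IsIsometry} {C : D₂.PunctureChart σ L} (hC : C.IsFlat) : (C.ofIso e he).IsFlat :=
    fun z z' γ' γ hγ' hγ y => by
  rw [ofIso_e_apply, ofIso_e_apply, Hom.appRat_transport]
  exact hC γ' γ hγ' hγ _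

end PunctureChart

/-! ## §4 The bundles of charts along an isometric isomorphism -/

variable {α ι : Type*} {ψ : α → OpenPartialHomeomorph S ℂ} {σ : ι → ℂ → S}

/-- **`IsCharted` is invariant under isometric isomorphism**: charts of `D₂` on the discs `ψ a` and the ends `σ i` give charts of `D₁ ≅ D₂`.
[cite: Schmid1973, §2] [cite: CattaniDeligneKaplan1995, §1 (p. 484)] -/
theorem IsCharted.ofIso (e : Iso D₁ D₂) (he : e.hom.IsIsometry) (h : D₂.IsCharted ψ σ) : D₁.IsCharted ψ σ := by
  refine ⟨fun a => ?_, fun i => ?_⟩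
  · obtain ⟨V, _, _, _, H₀, P₀, ⟨C⟩⟩ := h.interior a
    exact ⟨V, inferInstance, inferInstance, inferInstance, H₀, P₀, ⟨C.ofIso e he⟩⟩
  · obtain ⟨V, _, _, _, L, ⟨C⟩⟩ := h.puncture i
    exact ⟨V, inferInstance, inferInstance, inferInstance, L, ⟨C.ofIso e he⟩⟩

/-- **`IsFlatCharted` is invariant under isometric isomorphism.** [cite: Schmid1973, §2] [cite: CattaniDeligneKaplan1995, §1 (p. 484)] -/
theorem IsFlatCharted.ofIso (e : Iso D₁ D₂) (he : e.hom.IsIsometry) (h : D₂.IsFlatCharted ψ σ) : D₁.IsFlatCharted ψ σ := by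
  refine ⟨fun a => ?_, fun i => ?_⟩
  · obtain ⟨V, _, _, _, H₀, P₀, C, hC⟩ := h.interior a
    exact ⟨V, inferInstance, inferInstance, inferInstance, H₀, P₀, C.ofIso e he, hC.ofIso⟩
  · obtain ⟨V, _, _, _, L, C, hC⟩ := h.puncture i
    exact ⟨V, inferInstance, inferInstance, inferInstance, L, C.ofIso e he, hC.ofIso⟩

/-- **`IsLocallyCharted` is invariant under isometric isomorphism.** [cite: Schmid1973, §2] [cite: CattaniDeligneKaplan1995, §1 (pp. 483–484)] -/
theorem IsLocallyCharted.ofIso (e : Iso D₁ D₂) (he : e.hom.IsIsometry) (h : D₂.IsLocallyCharted ψ σ) : D₁.IsLocallyCharted ψ σ := by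
  refine ⟨fun a x hx => ?_, fun i => ?_⟩
  · obtain ⟨r, hr, hB, V, _, _, _, H₀, P₀, ⟨C⟩⟩ := h.interior a x hx
    exact ⟨r, hr, hB, V, inferInstance, inferInstance, inferInstance, H₀, P₀, ⟨C.ofIso e he⟩⟩
  · obtain ⟨V, _, _, _, L, ⟨C⟩⟩ := h.puncture i
    exact ⟨V, inferInstance, inferInstance, inferInstance, L, ⟨C.ofIso e he⟩⟩

/-- **`IsLocallyFlatCharted` is invariant under isometric isomorphism.** [cite: Schmid1973, §2] [cite: CattaniDeligneKaplan1995, §1 (pp. 483–484)] -/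
theorem IsLocallyFlatCharted.ofIso (e : Iso D₁ D₂) (he : e.hom.IsIsometry) (h : D₂.IsLocallyFlatCharted ψ σ) : D₁.IsLocallyFlatCharted ψ σ := by
  refine ⟨fun a x hx => ?_, fun i => ?_⟩
  · obtain ⟨r, hr, hB, V, _, _, _, H₀, P₀, C, hC⟩ := h.interior a x hx
    exact ⟨r, hr, hB, V, inferInstance, inferInstance, inferInstance, H₀, P₀, C.ofIso e he, hC.ofIso⟩
  · obtain ⟨V, _, _, _, L, C, hC⟩ := h.puncture i
    exact ⟨V, inferInstance, inferInstance, inferInstance, L, C.ofIso e he, hC.ofIso⟩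

/-- The symmetric direction: charts of `D₁` give charts of `D₂` (through `e⁻¹`, an isometry). [cite: Schmid1973, §2] -/
theorem IsLocallyCharted.ofIso_symm (e : Iso D₁ D₂) (he : e.hom.IsIsometry) (h : D₁.IsLocallyCharted ψ σ) : D₂.IsLocallyCharted ψ σ :=
  h.ofIso e.symm (e.isIsometry_inv he)

/-- The symmetric direction for flat charts. [cite: Schmid1973, §2] -/
theorem IsLocallyFlatCharted.ofIso_symm (e : Iso D₁ D₂) (he : e.hom.IsIsometry) (h : D₁.IsLocallyFlatCharted ψ σ) : D₂.IsLocallyFlatCharted ψ σ :=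
  h.ofIso e.symm (e.isIsometry_inv he)

/-- **Isometrically isomorphic VHS data are locally charted together.** [cite: Schmid1973, §2] -/
theorem isLocallyCharted_iff_of_iso (e : Iso D₁ D₂) (he : e.hom.IsIsometry) : D₁.IsLocallyCharted ψ σ ↔ D₂.IsLocallyCharted ψ σ :=
  ⟨fun h => h.ofIso_symm e he, fun h => h.ofIso e he⟩

/-- **Isometrically isomorphic VHS data are locally flat-charted together.** [cite: Schmid1973, §2] -/
theorem isLocallyFlatCharted_iff_of_iso (e : Iso D₁ D₂) (he : e.hom.IsIsometry) : D₁.IsLocallyFlatCharted ψ σ ↔ D₂.IsLocallyFlatCharted ψ σ :=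
  ⟨fun h => h.ofIso_symm e he, fun h => h.ofIso e he⟩

/-! ## §5 Charts of `f^*(T^{a,b}D)`, `f^*(D^∨)`, `f^*Hom(D₁, D₂)` from charts of the pull-backs -/

section Comap

variable {S' : Type} [TopologicalSpace S'] (f : C(S', S)) {D : VHSData S k}
variable {α' ι' : Type*} {ψ' : α' → OpenPartialHomeomorph S' ℂ} {σ' : ι' → ℂ → S'}

/-- **FLAT CHARTS OF `f^*(T^{a,b}D)` FROM FLAT CHARTS OF `f^*D`** (`f^*(T^{a,b}D) ≅ T^{a,b}(f^*D)` isometrically: the tree's `Iso.tensorSpaceComap`; the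
chart layer is closed under `T^{a,b}`: `IsLocallyFlatCharted.tensorSpace`) — the tensor constructions of the pulled-back variation on the finite étale
cover of the printed proof. [cite: CattaniDeligneKaplan1995, §1 (p. 484), «Proof of 1.5 ⟹ 1.1» (p. 485)] [cite: Deligne1970, I.1] [cite: Schmid1973, §2] -/
theorem IsLocallyFlatCharted.comap_tensorSpace (h : (D.comap f).IsLocallyFlatCharted ψ' σ') (a b : ℕ) :
    ((D.tensorSpace a b).comap f).IsLocallyFlatCharted ψ' σ' :=
  (h.tensorSpace a b).ofIso (Iso.tensorSpaceComap f D a b) (Iso.isIsometry_tensorSpaceComap_hom f D a b)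

/-- **CHARTS OF `f^*(T^{a,b}D)` FROM CHARTS OF `f^*D`.** [cite: CattaniDeligneKaplan1995, §1 (p. 484), «Proof of 1.5 ⟹ 1.1» (p. 485)] [cite: Deligne1970, I.1] -/
theorem IsLocallyCharted.comap_tensorSpace (h : (D.comap f).IsLocallyCharted ψ' σ') (a b : ℕ) :
    ((D.tensorSpace a b).comap f).IsLocallyCharted ψ' σ' :=
  (h.tensorSpace a b).ofIso (Iso.tensorSpaceComap f D a b) (Iso.isIsometry_tensorSpaceComap_hom f D a b)

/-- **FLAT CHARTS OF `f^*(D^∨)` FROM FLAT CHARTS OF `f^*D`** (`f^*(D^∨) ≅ (f^*D)^∨` isometrically: `Iso.dualComap`). [cite: Deligne1970, I.1] [cite: Schmid1973, §2] -/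
theorem IsLocallyFlatCharted.comap_dual (h : (D.comap f).IsLocallyFlatCharted ψ' σ') : (D.dual.comap f).IsLocallyFlatCharted ψ' σ' :=
  h.dual.ofIso (Iso.dualComap f D) (Iso.isIsometry_dualComap_hom f D)

/-- **CHARTS OF `f^*(D^∨)` FROM CHARTS OF `f^*D`.** [cite: Deligne1970, I.1] [cite: Schmid1973, §2] -/
theorem IsLocallyCharted.comap_dual (h : (D.comap f).IsLocallyCharted ψ' σ') : (D.dual.comap f).IsLocallyCharted ψ' σ' :=
  h.dual.ofIso (Iso.dualComap f D) (Iso.isIsometry_dualComap_hom f D)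

/-- **FLAT CHARTS OF `f^*Hom(D₁, D₂)` FROM FLAT CHARTS OF `f^*D₁`, `f^*D₂`** (`D₁`, `D₂` of the same weight, as in the tree's `Iso.homComap`:
`f^*Hom(D₁, D₂) ≅ Hom(f^*D₁, f^*D₂)` isometrically).
[cite: Deligne1970, I.1] [cite: Schmid1973, §2] -/
theorem IsLocallyFlatCharted.comap_hom {E₁ E₂ : VHSData S k} (h₁ : (E₁.comap f).IsLocallyFlatCharted ψ' σ')
    (h₂ : (E₂.comap f).IsLocallyFlatCharted ψ' σ') : ((E₁.hom E₂).comap f).IsLocallyFlatCharted ψ' σ' :=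
  (h₁.hom h₂).ofIso (Iso.homComap f E₁ E₂) (Iso.isIsometry_homComap_hom f E₁ E₂)

/-- **CHARTS OF `f^*Hom(D₁, D₂)` FROM CHARTS OF `f^*D₁`, `f^*D₂`** (same weight). [cite: Deligne1970, I.1] [cite: Schmid1973, §2] -/
theorem IsLocallyCharted.comap_hom {E₁ E₂ : VHSData S k} (h₁ : (E₁.comap f).IsLocallyCharted ψ' σ')
    (h₂ : (E₂.comap f).IsLocallyCharted ψ' σ') : ((E₁.hom E₂).comap f).IsLocallyCharted ψ' σ' :=
  (h₁.hom h₂).ofIso (Iso.homComap f E₁ E₂) (Iso.isIsometry_homComap_hom f E₁ E₂)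

end Comap

end Motives.VHSData

end Literature.AlgebraicGeometry

end
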